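import Summits.AtomisticToContinuum.HydrodynamicLimit.Theses.MourreKoopmanCharges
import Summits.AtomisticToContinuum.HydrodynamicLimit.Theorems.ImplosionDichotomyHydroLimitInBandSplit
import Summits.AtomisticToContinuum.HydrodynamicLimit.Theorems.MourreKoopmanChargesLinearToEntropyInBandDefs
import Summits.AtomisticToContinuum.HydrodynamicLimit.Theorems.MourreKoopmanChargesLinearToEntropyInBandDock
import HarnessLib

/-!
# Route `MourreKoopmanCharges`, crux `LinearToEntropyInBand` (stmt-AtomisticToContinuum-17740), skeleton v5:
# the static clause leaves stub 4 (glue S3), and PATH B is fully landed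

Support file (`--supports stmt-AtomisticToContinuum-17740`, registered stubs `glue_oneWindowLedgerStatic_of_windowClause`
and `relEntropyVanishingInBand_of_lineInputs`) of the line `registered`, skeleton v5
(`Cruxes/LinearToEntropyInBand/Lines/birth.lean`, lead prover-line-…-17740-c4-0).

* **S3.**  The one-window entropy ledger with static telescoping, `ClampedCurrentsDockFromWindows.OneWindowLedgerStatic`
  (the heart of the sibling cruxes 9133/14680), is the conjunction of a STATIC clause (`log Z_pos(t') − log Z_pos(0)`
  against the explicit centring `Cst`, LANDED unconditionally: `HydroLimitInBandHeart.stub_staticClause`) and a WINDOW clause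
  (`HydroLimitInBandHeart.WindowClauseInBand`, Yau's one-window entropy inequality in the band); the landed
  `HydroLimitInBandSplit.oneWindowLedgerStatic_of_clauses` assembles them.  Hence the line's stub 4a only owes the window
  clause from visible flux-Gibbsianity and the two truncation inputs: `glue_oneWindowLedgerStatic_of_windowClause`.
* **PATH B (planner information, not this line's composition).**  The crux's consequent `RelEntropyVanishingInBand`
  follows from the five conjecture-grade inputs `HydroLimitInBandOfHeart.LineInputs` of line `IdeatorOneSketch` of crux 9133
  (local clamped transfer window LD along families, energy-activity tails, weighted coherence, KCWU along families, CAT 13734,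
  ECT 9235) with NO Mourre hypothesis, now that the heart (`HydroLimitInBandSplit.oneWindowLedger_holds`) and the window
  continuity (`HydroLimitInBandContinuity.stub_windowContinuityInBand`, p118327) are both landed:
  `relEntropyVanishingInBand_of_lineInputs` (c3 recorded the same with the heart and the continuity as hypotheses,
  `LTEInBand.relEntropyVanishingInBand_of_heart`).  The bridge is over-determined by the OneFlightGossipEngine chain.

Reference: H.-T. Yau, Lett. Math. Phys. 22 (1991) §2.
-/

noncomputable section

namespace Summit.AtomisticToContinuum.HydrodynamicLimit.Theorems.LTEInBand

open Summit.AtomisticToContinuum.HydrodynamicLimit.Theorems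

/-- **S3 (skeleton v5): the static clause is landed, so the window clause in band gives the static one-window ledger** —
for every packing level and every triple of inputs, `HydroLimitInBandSplit.oneWindowLedgerStatic_of_clauses` fed with
`HydroLimitInBandHeart.stub_staticClause`. [cite: Yau1991, §2] -/
theorem glue_oneWindowLedgerStatic_of_windowClause : (∀ η : ℝ, 0 < η → Summit.AtomisticToContinuum.HydrodynamicLimit.Theorems.LTEInBand.VisibleFluxGibbsianity → Summit.AtomisticToContinuum.HydrodynamicLimit.Theorems.LTEInBand.EnergyCurrentTailsBelow η → Summit.AtomisticToContinuum.HydrodynamicLimit.Theorems.LTEInBand.FastCollisionThroughputBelow η → Summit.AtomisticToContinuum.HydrodynamicLimit.Theorems.HydroLimitInBandHeart.WindowClauseInBand) → (∀ η : ℝ, 0 < η → Summit.AtomisticToContinuum.HydrodynamicLimit.Theorems.LTEInBand.VisibleFluxGibbsianity → Summit.AtomisticToContinuum.HydrodynamicLimit.Theorems.LTEInBand.EnergyCurrentTailsBelow η → Summit.AtomisticToContinuum.HydrodynamicLimit.Theorems.LTEInBand.FastCollisionThroughputBelow η → Summit.AtomisticToContinuum.HydrodynamicLimit.Theorems.ClampedCurrentsDockFromWindows.OneWindowLedgerStatic)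 :=
  fun h η hη hV hE hF =>
    HydroLimitInBandSplit.oneWindowLedgerStatic_of_clauses HydroLimitInBandHeart.stub_staticClause (h η hη hV hE hF)

/-- **PATH B, fully landed: the crux's consequent from the five OneFlightGossipEngine line inputs** — the landed
composition `HydroLimitInBandOfHeart.gronwallCoreInBand_of_heart` fed the sorry-free heart
`HydroLimitInBandSplit.oneWindowLedger_holds` and the landed window continuity
`HydroLimitInBandContinuity.stub_windowContinuityInBand`, docked by S1 `stub_dockGronwallCoreInBand`.  No Mourre
hypothesis is used: recorded as planner information (the bridge is over-determined), not as this line's composition.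
[cite: Yau1991, §2] -/
theorem relEntropyVanishingInBand_of_lineInputs : Summit.AtomisticToContinuum.HydrodynamicLimit.Theorems.HydroLimitInBandOfHeart.LineInputs → Summit.AtomisticToContinuum.HydrodynamicLimit.Theses.MourreKoopmanCharges.RelEntropyVanishingInBand :=
  fun hI =>
    stub_dockGronwallCoreInBand
      (HydroLimitInBandOfHeart.gronwallCoreInBand_of_heart HydroLimitInBandSplit.oneWindowLedger_holds
        HydroLimitInBandContinuity.stub_windowContinuityInBand hI)

end Summit.AtomisticToContinuum.HydrodynamicLimit.Theorems.LTEInBand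

end
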